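import Summits.Schanuel.Schanuel.Theorems.RootDecomp1KMeasuredWallCell03

/-!
# RootDecomp1KMeasuredWallCell — lens 1, generation 38 «MEASURED WALL CELL of 33364» (the mixed wall (1, ℓ₂, ℓ₃, ρ) for every ρ in the tree class LogHyperLiouville) — continuation (RootDecomp1KMeasuredWallCell04): §4 (M) the BLOCK MEASURE `induced_logPow_measure_cons_two_three`, `logPowMeasure_cons_two_three (hθ : MvPolyMeasure θ) : LogPowMeasure (ℓ₂, ℓ₃, θ)` (θ⃗ quantified, exponent d+3), instances `logPowMeasure_two_three_exp_one (hNW)`, `logPowMeasure_two_three_pi` (free)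

(lens-1 g38 `RootDecomp1KMeasuredWallCell.lean` [HOME/decomp-schanuel-lens-1/g38/RootDecomp1KMeasuredWallCell.lean sha256 168ec8e8…3303, 1895 l + MWprobe 0edab326… + MWctrl b192be9d… + NODE-g38.md 03a7462f…; NOTE/CLAIM L1764, ACK + CHECKLIST K-g38 L1782, NODE L1785 / REQUEST L1786 / RESULT L1787; writer re-check L1790]; port by census-1 gen 16 in seven parts
`RootDecomp1KMeasuredWallCell01`–`07` — see the PORT NOTE of part 01; `--supports stmt-Schanuel-33364`; rung 0.)
-/

noncomputable section

open Complex IntermediateField Polynomial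
open Summit.Schanuel.Schanuel.Theorems.RootDecomp1KHyper
open Summit.Schanuel.Schanuel.Theorems.RootDecomp1KHyper.HyperCell
open Summit.Schanuel.Schanuel.Theorems.RootDecomp1KGeneric
open Summit.Schanuel.Schanuel.Theorems.RootDecomp1KRelLiouvilleCell
open Summit.Schanuel.Schanuel.Theorems.RootDecomp1KLogLogCell (LogLogLiouville logLogLiouville_of_logHyperLiouville)
open Summit.Schanuel.Schanuel.Theorems.RootDecomp1KTwoBaseCell

namespace Summit.Schanuel.Schanuel.Theorems.RootDecomp1KMeasuredWallCell

open LiouvilleNumber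
open scoped Nat

section BlockMeasure
open LiouvilleNumber
open scoped Nat

variable {n : ℕ}

/-- `6 ≤ e²`. -/
private theorem six_le_exp_two' : (6 : ℝ) ≤ Real.exp 2 := by
  have h : Real.exp 2 = Real.exp 1 ^ 2 := by rw [← Real.exp_nat_mul]; norm_num
  rw [h]
  have h1 := Real.exp_one_gt_d9
  calc (6 : ℝ) ≤ (2.7182818283 : ℝ) ^ 2 := by norm_num
    _ ≤ Real.exp 1 ^ 2 := pow_le_pow_left₀ (by norm_num) h1.le 2

/-- **(M) THE BLOCK MEASURE (kernel; the new object of this node).** If `θ = (θ₁,…,θₙ)` has a polynomial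
measure of algebraic independence (`MvPolyMeasure θ`), then `(ℓ₂, ℓ₃, θ₁, …, θₙ)` has a LOG-POWER measure with the
explicit exponent `d + 3`: `|P(ℓ₂, ℓ₃, θ)| ≥ exp(−C (1 + log len P)^{d+3})` for all non-zero `P ∈ ℤ[X₀,…,X_{n+1}]`
of total degree `≤ d`.  Mechanism: the 2-adic WINDOW ZERO ESTIMATE `window_nonvanishing` supplies, uniformly in
`P` (window `[M+1, M+1+d]`, `2^{M!} ≳ len P`), a scale `K` at which the integer specialisation
`H = 6^{dK!} P(s²_K, s³_K, X⃗)` is NON-ZERO (`wspec_ne_zero` ∘ `sliceXY_ne_zero`); the measure of `θ` bounds `|H(θ)|`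
below; the factorial tails `|ℓ_b − s^b_K| ≤ 2·2^{−(K+1)!}` are smaller by the window inequality
`Y · 6^{K! d(τ+1)} ≤ 2^{(K+1)!}` (`K ≥ 3d(τ+1)`).  No named fact enters. -/
theorem induced_logPow_measure_cons_two_three {θ : Fin n → ℂ} (hθ : MvPolyMeasure θ) (d : ℕ) :
    ∃ C : ℝ, 0 < C ∧ ∀ P : MvPolynomial (Fin (n + 2)) ℤ, P ≠ 0 → P.totalDegree ≤ d →
      Real.exp (-(C * (1 + Real.log ((mvlen P : ℤ) : ℝ)) ^ (d + 3))) ≤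
        ‖MvPolynomial.aeval (Fin.cons ((liouvilleNumber 2 : ℝ) : ℂ)
          (Fin.cons ((liouvilleNumber 3 : ℝ) : ℂ) θ) : Fin (n + 2) → ℂ) P‖ := by
  classical
  obtain ⟨C₀, τ, hC₀, hmeas₀⟩ := hθ d
  -- WLOG the measure constant is ≥ 1
  set Cθ : ℝ := max C₀ 1 with hCθdef
  have hCθ1 : 1 ≤ Cθ := le_max_right _ _
  have hCθ : 0 < Cθ := by linarith
  have hmeas : ∀ P : MvPolynomial (Fin n) ℤ, P ≠ 0 → P.totalDegree ≤ d →
      1 ≤ Cθ * ((mvlen P : ℤ) : ℝ) ^ τ * ‖MvPolynomial.aeval θ P‖ := by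
    intro P hP hdeg
    refine (hmeas₀ P hP hdeg).trans ?_
    have h0 : (0 : ℝ) ≤ ((mvlen P : ℤ) : ℝ) ^ τ := pow_nonneg (by exact_mod_cast mvlen_nonneg P) τ
    exact mul_le_mul_of_nonneg_right (mul_le_mul_of_nonneg_right (le_max_left _ _) h0)
      (norm_nonneg _)
  -- the size of θ and the constants of the node
  set B : ℝ := 2 + ∑ i, ‖θ i‖ with hBdef
  have hsum0 : 0 ≤ ∑ i, ‖θ i‖ := Finset.sum_nonneg fun i _ => norm_nonneg _
  have hB2 : 2 ≤ B := by rw [hBdef]; linarith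
  have hB1 : 1 ≤ B := by linarith
  have hθB : ∀ i, ‖θ i‖ ≤ B := fun i => by
    have := Finset.single_le_sum (f := fun i => ‖θ i‖) (fun i _ => norm_nonneg _)
      (Finset.mem_univ i)
    rw [hBdef]; linarith
  set Γ : ℝ := (d : ℝ) * B ^ d + 1 with hΓdef
  have hΓ0 : (0 : ℝ) ≤ (d : ℝ) * B ^ d := by positivity
  have hΓ1 : 1 ≤ Γ := by rw [hΓdef]; linarith
  have hΓpos : 0 < Γ := by linarith
  set C₁ : ℝ := Cθ * ((2 : ℝ) ^ d) ^ τ with hC₁def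
  have hC₁1 : 1 ≤ C₁ := by
    rw [hC₁def]
    exact one_le_mul_of_one_le_of_one_le hCθ1 (one_le_pow₀ (one_le_pow₀ (by norm_num)))
  have hC₁pos : 0 < C₁ := by linarith
  set E : ℕ := d * (τ + 1) with hEdef
  set Nd : ℕ := 3 * E + (d + 2) with hNddef
  have h4ΓC₁ : (1 : ℝ) ≤ 4 * Γ * C₁ := one_le_mul_of_one_le_of_one_le (by linarith) hC₁1
  have hlog4 : 0 ≤ Real.log (4 * Γ * C₁) := Real.log_nonneg h4ΓC₁
  set cY : ℝ := Real.log (4 * Γ * C₁) + 1 + τ + 1 with hcYdef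
  have hcY1 : 1 ≤ cY := by rw [hcYdef]; linarith [(Nat.cast_nonneg τ : (0 : ℝ) ≤ τ)]
  have hcY0 : 0 ≤ cY := by linarith
  set A₀ : ℝ := (((Nd ! : ℕ) : ℝ) + (2 * cY + 1) ^ 2) *
    ((Nd : ℝ) + ((d + 1 : ℕ) : ℝ) + 2 * cY + 1) ^ (d + 1) with hA₀def
  have hA₀0 : 0 ≤ A₀ := by positivity
  set D : ℝ := 2 * (E : ℝ) with hDdef
  have hD0 : 0 ≤ D := by positivity
  set Cst : ℝ := 2 * C₁ + τ + D * A₀ + 1 with hCstdef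
  refine ⟨Cst, by positivity, fun P hP hdeg => ?_⟩
  clear_value Cst A₀ cY C₁ Γ B Cθ D
  -- notation for P
  set L : ℝ := ((mvlen P : ℤ) : ℝ) with hLdef
  have hL1 : 1 ≤ L := by rw [hLdef]; exact_mod_cast one_le_mvlen hP
  have hL0 : 0 ≤ L := by linarith
  have hlogL0 : 0 ≤ Real.log L := Real.log_nonneg hL1
  set u : ℝ := 1 + Real.log L with hudef
  have hu1 : 1 ≤ u := by rw [hudef]; linarith
  have hu0 : 0 ≤ u := by linarith
  have hℓ₂pos : 0 < liouvilleNumber 2 := liouvilleNumber_two_pos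
  have hℓ₂lt : liouvilleNumber 2 < 3 / 2 := liouvilleNumber_two_lt
  have hℓ₃lt : liouvilleNumber 3 < 1 := liouvilleNumber_three_lt_one
  have hℓ₃pos : 0 < liouvilleNumber 3 := by
    have := partialSum_pos_lt (by norm_num : (1 : ℝ) < 3) 0
    linarith [this.1, this.2]
  -- Lipschitz: ‖P(ℓ₂,ℓ₃,θ) − P(s²_K, s³_K, θ)‖ ≤ Γ L · 2·2^{−(K+1)!}
  have hLsum : (∑ e ∈ P.support, |((P.coeff e : ℤ) : ℝ)|) = L := by
    rw [hLdef]; unfold mvlen; push_cast; rfl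
  have htail : ∀ K : ℕ,
      ‖MvPolynomial.aeval (Fin.cons ((liouvilleNumber 2 : ℝ) : ℂ)
          (Fin.cons ((liouvilleNumber 3 : ℝ) : ℂ) θ) : Fin (n + 2) → ℂ) P -
        MvPolynomial.aeval (Fin.cons ((partialSum 2 K : ℝ) : ℂ)
          (Fin.cons ((partialSum 3 K : ℝ) : ℂ) θ) : Fin (n + 2) → ℂ) P‖ ≤
        Γ * L * (2 / 2 ^ (K + 1)!) := by
    intro K
    have hs2 := partialSum_pos_lt (by norm_num : (1 : ℝ) < 2) K
    have hs3 := partialSum_pos_lt (by norm_num : (1 : ℝ) < 3) K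
    have hδ : (0 : ℝ) ≤ 2 / 2 ^ (K + 1)! := by positivity
    have hx : ∀ i, ‖(Fin.cons ((liouvilleNumber 2 : ℝ) : ℂ)
        (Fin.cons ((liouvilleNumber 3 : ℝ) : ℂ) θ) : Fin (n + 2) → ℂ) i‖ ≤ B := by
      intro i
      refine Fin.cases ?_ (fun i' => ?_) i
      · simp only [Fin.cons_zero, Complex.norm_real, Real.norm_eq_abs]
        rw [abs_of_pos hℓ₂pos]; linarith
      · refine Fin.cases ?_ (fun j => ?_) i'
        · simp only [Fin.cons_succ, Fin.cons_zero, Complex.norm_real, Real.norm_eq_abs]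
          rw [abs_of_pos hℓ₃pos]; linarith
        · simp only [Fin.cons_succ]; exact hθB j
    have hy : ∀ i, ‖(Fin.cons ((partialSum 2 K : ℝ) : ℂ)
        (Fin.cons ((partialSum 3 K : ℝ) : ℂ) θ) : Fin (n + 2) → ℂ) i‖ ≤ B := by
      intro i
      refine Fin.cases ?_ (fun i' => ?_) i
      · simp only [Fin.cons_zero, Complex.norm_real, Real.norm_eq_abs]
        rw [abs_of_pos hs2.1]; linarith
      · refine Fin.cases ?_ (fun j => ?_) i'
        · simp only [Fin.cons_succ, Fin.cons_zero, Complex.norm_real, Real.norm_eq_abs]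
          rw [abs_of_pos hs3.1]; linarith
        · simp only [Fin.cons_succ]; exact hθB j
    have hxy : ∀ i, ‖(Fin.cons ((liouvilleNumber 2 : ℝ) : ℂ)
        (Fin.cons ((liouvilleNumber 3 : ℝ) : ℂ) θ) : Fin (n + 2) → ℂ) i -
        (Fin.cons ((partialSum 2 K : ℝ) : ℂ)
          (Fin.cons ((partialSum 3 K : ℝ) : ℂ) θ) : Fin (n + 2) → ℂ) i‖ ≤ 2 / 2 ^ (K + 1)! := by
      intro i
      refine Fin.cases ?_ (fun i' => ?_) i
      · simp only [Fin.cons_zero]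
        rw [← Complex.ofReal_sub, Complex.norm_real, Real.norm_eq_abs]
        exact abs_liouvilleNumber_sub_partialSum_le (by norm_num) K
      · refine Fin.cases ?_ (fun j => ?_) i'
        · simp only [Fin.cons_succ, Fin.cons_zero]
          rw [← Complex.ofReal_sub, Complex.norm_real, Real.norm_eq_abs]
          exact abs_liouvilleNumber_sub_partialSum_le (by norm_num) K
        · simp only [Fin.cons_succ, sub_self, norm_zero]; exact hδ
    have h := norm_aeval_sub_aeval_le P hB1 hδ hx hy hxy hdeg
    rw [hLsum] at h
    refine h.trans ?_
    have hΓ' : (d : ℝ) * B ^ d ≤ Γ := by rw [hΓdef]; linarith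
    calc L * ((d : ℝ) * B ^ d * (2 / 2 ^ (K + 1)!))
        = ((d : ℝ) * B ^ d) * (L * (2 / 2 ^ (K + 1)!)) := by ring
      _ ≤ Γ * (L * (2 / 2 ^ (K + 1)!)) := mul_le_mul_of_nonneg_right hΓ' (by positivity)
      _ = Γ * L * (2 / 2 ^ (K + 1)!) := by ring
  -- the window index N₀: Y ≤ 2^{N₀!}, N₀ ≥ N_d
  set Y : ℝ := 4 * Γ * C₁ * L ^ (1 + τ) with hYdef
  have hLpow1 : L ≤ L ^ (1 + τ) := by
    calc L = L ^ 1 := (pow_one L).symm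
      _ ≤ L ^ (1 + τ) := pow_le_pow_right₀ hL1 (by omega)
  have hLpow1' : 1 ≤ L ^ (1 + τ) := hL1.trans hLpow1
  have hY1 : 1 ≤ Y := by
    rw [hYdef]; exact one_le_mul_of_one_le_of_one_le h4ΓC₁ hLpow1'
  have hYpos : 0 < Y := lt_of_lt_of_le one_pos hY1
  have hY4L : 4 * L ≤ Y := by
    rw [hYdef]
    have h1 : 4 * L ≤ 4 * L ^ (1 + τ) := by linarith
    have h2 : 4 * L ^ (1 + τ) = 4 * 1 * 1 * L ^ (1 + τ) := by ring
    rw [h2] at h1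
    refine h1.trans ?_
    have := mul_le_mul (mul_le_mul_of_nonneg_left hΓ1 (by norm_num : (0:ℝ) ≤ 4)) hC₁1
      (by norm_num) (by positivity)
    exact mul_le_mul_of_nonneg_right this (by positivity)
  have hlogY : Real.log Y ≤ cY * u := by
    have e1 : Real.log Y = Real.log (4 * Γ * C₁) + (1 + τ) * Real.log L := by
      rw [hYdef, Real.log_mul (by positivity) (by positivity), Real.log_pow]; push_cast; ring
    rw [e1, hcYdef]
    have h1 : (1 + (τ : ℝ)) * Real.log L ≤ (1 + τ) * u := by
      apply mul_le_mul_of_nonneg_left _ (by positivity); rw [hudef]; linarith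
    have h2 : Real.log (4 * Γ * C₁) * 1 ≤ Real.log (4 * Γ * C₁) * u :=
      mul_le_mul_of_nonneg_left hu1 hlog4
    have e2 : (Real.log (4 * Γ * C₁) + 1 + τ + 1) * u =
        Real.log (4 * Γ * C₁) * u + (1 + τ) * u + u := by ring
    rw [e2]
    linarith
  have hlogY0 : 0 ≤ Real.log Y := Real.log_nonneg hY1
  clear_value Y
  obtain ⟨N₀, hN₀d, hN₀Y, hN₀fact, hN₀le⟩ := exists_window_index Y hY1 Nd
  -- the slice at a support exponent and THE WINDOW ZERO ESTIMATE
  have hsupp : P.support.Nonempty :=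
    Finset.nonempty_iff_ne_empty.mpr fun h => hP (MvPolynomial.support_eq_empty.mp h)
  obtain ⟨e₀, he₀⟩ := hsupp
  set F : ℤ[X][X] := sliceXY P (Finsupp.tail (Finsupp.tail e₀)) with hFdef
  have hF0 : F ≠ 0 := sliceXY_ne_zero P he₀
  have hLZ : mvlen P < 2 ^ N₀ ! := by
    have h1 : L < (2 : ℝ) ^ N₀ ! := by linarith
    rw [hLdef] at h1
    exact_mod_cast h1
  obtain ⟨K, hK1, hK2, hKne⟩ := window_nonvanishing F hF0 (natDegree_sliceXY_le P hdeg _)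
    (natDegree_coeff_sliceXY_le P hdeg _) (abs_coeff_coeff_sliceXY_le P _) hLZ
    (by omega : d + 2 ≤ N₀)
  have hNN₀ : N₀ ≤ K := by omega
  have hKle : K ≤ N₀ + (d + 1) := by omega
  have hNdK : Nd ≤ K := hN₀d.trans hNN₀
  -- the window point (s²_K, s³_K) = (a₂/q₂, a₃/q₃)
  set s2 : ℝ := partialSum 2 K with hs2def
  set s3 : ℝ := partialSum 3 K with hs3def
  have hs2 := partialSum_pos_lt (by norm_num : (1 : ℝ) < 2) K
  have hs3 := partialSum_pos_lt (by norm_num : (1 : ℝ) < 3) K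
  rw [← hs2def] at hs2
  rw [← hs3def] at hs3
  set a₂ : ℤ := (psNumer 2 K : ℤ) with ha₂def
  set a₃ : ℤ := (psNumer 3 K : ℤ) with ha₃def
  set q₂ : ℕ := 2 ^ K ! with hq₂def
  set q₃ : ℕ := 3 ^ K ! with hq₃def
  have hq₂0 : q₂ ≠ 0 := by positivity
  have hq₃0 : q₃ ≠ 0 := by positivity
  have hq₂pos : (0 : ℝ) < q₂ := by positivity
  have hq₃pos : (0 : ℝ) < q₃ := by positivity
  have hs2eq : s2 = (a₂ : ℝ) / (q₂ : ℝ) := by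
    have := partialSum_eq_psNumer_div (b := 2) (by norm_num) K
    simp only [Nat.cast_ofNat] at this
    rw [hs2def, this, ha₂def, hq₂def]; push_cast; rfl
  have hs3eq : s3 = (a₃ : ℝ) / (q₃ : ℝ) := by
    have := partialSum_eq_psNumer_div (b := 3) (by norm_num) K
    simp only [Nat.cast_ofNat] at this
    rw [hs3def, this, ha₃def, hq₃def]; push_cast; rfl
  have hpsQ2 : psQ 2 K = (a₂ : ℚ) / (q₂ : ℚ) := by
    rw [psQ_eq_div (by norm_num), ha₂def, hq₂def]; push_cast; rfl
  have hpsQ3 : psQ 3 K = (a₃ : ℚ) / (q₃ : ℚ) := by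
    rw [psQ_eq_div (by norm_num), ha₃def, hq₃def]; push_cast; rfl
  rw [hpsQ2, hpsQ3] at hKne
  -- the integer specialisation H = 6^{dK!} P(s²_K, s³_K, X⃗)
  set H : MvPolynomial (Fin n) ℤ := wspec P d a₂ a₃ q₂ q₃ with hHdef
  have hH0 : H ≠ 0 := wspec_ne_zero P hdeg a₂ a₃ hq₂0 hq₃0 hKne
  have hHdeg : H.totalDegree ≤ d := totalDegree_wspec_le P hdeg _ _ _ _
  have ha₂ : |a₂| ≤ 2 * (q₂ : ℤ) := by
    rw [abs_of_nonneg (by positivity)]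
    have h1 : (a₂ : ℝ) / q₂ < 2 := by rw [← hs2eq]; linarith [hs2.2]
    have h2 : (a₂ : ℝ) < 2 * q₂ := by rwa [div_lt_iff₀ hq₂pos] at h1
    exact_mod_cast h2.le
  have ha₃ : |a₃| ≤ (q₃ : ℤ) := by
    rw [abs_of_nonneg (by positivity)]
    have h1 : (a₃ : ℝ) / q₃ < 1 := by rw [← hs3eq]; linarith [hs3.2]
    have h2 : (a₃ : ℝ) < q₃ := by rwa [div_lt_one hq₃pos] at h1
    exact_mod_cast h2.le
  set G : ℝ := (6 : ℝ) ^ K ! with hGdef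
  have hq₂q₃ : (q₂ : ℝ) * (q₃ : ℝ) = G := by
    rw [hGdef, hq₂def, hq₃def]; push_cast; rw [← mul_pow]; norm_num
  have hG1 : 1 ≤ G := by rw [hGdef]; exact one_le_pow₀ (by norm_num)
  have hGpos : 0 < G := by linarith
  -- the length of H
  have hq₂Z : (0 : ℤ) ≤ (q₂ : ℤ) := Int.natCast_nonneg _
  have hlenHZ : mvlen H ≤ (2 * (q₂ : ℤ) * q₃) ^ d * mvlen P :=
    mvlen_wspec_le P hdeg (A₂ := 2 * (q₂ : ℤ)) (A₃ := (q₃ : ℤ)) ha₂ (by linarith) ha₃ le_rfl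
  have hlenH : ((mvlen H : ℤ) : ℝ) ≤ (2 : ℝ) ^ d * G ^ d * L := by
    have h1 : ((mvlen H : ℤ) : ℝ) ≤ (((2 * (q₂ : ℤ) * q₃) ^ d * mvlen P : ℤ) : ℝ) := by
      exact_mod_cast hlenHZ
    refine h1.trans (le_of_eq ?_)
    push_cast
    rw [← hLdef, ← hq₂q₃]
    ring
  have hlenH0 : (0 : ℝ) ≤ ((mvlen H : ℤ) : ℝ) := by exact_mod_cast mvlen_nonneg H
  -- H(θ) = G^d · P(s²_K, s³_K, θ)
  have hpt2 : ((s2 : ℝ) : ℂ) = ((a₂ : ℤ) : ℂ) / ((q₂ : ℕ) : ℂ) := by rw [hs2eq]; push_cast; rfl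
  have hpt3 : ((s3 : ℝ) : ℂ) = ((a₃ : ℤ) : ℂ) / ((q₃ : ℕ) : ℂ) := by rw [hs3eq]; push_cast; rfl
  have hHe : MvPolynomial.aeval θ H = ((q₂ : ℂ) * q₃) ^ d *
      MvPolynomial.aeval (Fin.cons ((s2 : ℝ) : ℂ) (Fin.cons ((s3 : ℝ) : ℂ) θ) : Fin (n + 2) → ℂ) P := by
    rw [hHdef, mvaeval_wspec P hdeg a₂ a₃ hq₂0 hq₃0 θ, hpt2, hpt3]
  have hHnorm : ‖MvPolynomial.aeval θ H‖ = G ^ d *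
      ‖MvPolynomial.aeval (Fin.cons ((s2 : ℝ) : ℂ) (Fin.cons ((s3 : ℝ) : ℂ) θ) : Fin (n + 2) → ℂ) P‖ := by
    rw [hHe, norm_mul, norm_pow, norm_mul, Complex.norm_natCast, Complex.norm_natCast, hq₂q₃]
  -- the measure of θ at H:  X := (C₁ L^τ G^E)⁻¹ ≤ |P(s²_K, s³_K, θ)|
  have hmeasH := hmeas H hH0 hHdeg
  clear_value H
  have hlow : 1 ≤ C₁ * L ^ τ * G ^ E *
      ‖MvPolynomial.aeval (Fin.cons ((s2 : ℝ) : ℂ) (Fin.cons ((s3 : ℝ) : ℂ) θ) : Fin (n + 2) → ℂ) P‖ := by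
    rw [hHnorm] at hmeasH
    have e1 : ((mvlen H : ℤ) : ℝ) ^ τ ≤ ((2 : ℝ) ^ d * G ^ d * L) ^ τ :=
      pow_le_pow_left₀ hlenH0 hlenH τ
    have e3 : Cθ * ((mvlen H : ℤ) : ℝ) ^ τ ≤ Cθ * ((2 : ℝ) ^ d * G ^ d * L) ^ τ :=
      mul_le_mul_of_nonneg_left e1 hCθ.le
    calc (1 : ℝ) ≤ Cθ * ((mvlen H : ℤ) : ℝ) ^ τ * (G ^ d *
          ‖MvPolynomial.aeval (Fin.cons ((s2 : ℝ) : ℂ) (Fin.cons ((s3 : ℝ) : ℂ) θ) :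
            Fin (n + 2) → ℂ) P‖) := hmeasH
      _ ≤ Cθ * ((2 : ℝ) ^ d * G ^ d * L) ^ τ * (G ^ d *
          ‖MvPolynomial.aeval (Fin.cons ((s2 : ℝ) : ℂ) (Fin.cons ((s3 : ℝ) : ℂ) θ) :
            Fin (n + 2) → ℂ) P‖) := mul_le_mul_of_nonneg_right e3 (by positivity)
      _ = C₁ * L ^ τ * G ^ E *
          ‖MvPolynomial.aeval (Fin.cons ((s2 : ℝ) : ℂ) (Fin.cons ((s3 : ℝ) : ℂ) θ) :
            Fin (n + 2) → ℂ) P‖ := by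
          rw [hC₁def, hEdef, Nat.mul_succ, pow_add, pow_mul]
          simp only [mul_pow]
          ring
  set X : ℝ := (C₁ * L ^ τ * G ^ E)⁻¹ with hXdef
  have hDpos : 0 < C₁ * L ^ τ * G ^ E := by positivity
  have hXpos : 0 < X := inv_pos.mpr hDpos
  have hXle : X ≤
      ‖MvPolynomial.aeval (Fin.cons ((s2 : ℝ) : ℂ) (Fin.cons ((s3 : ℝ) : ℂ) θ) : Fin (n + 2) → ℂ) P‖ := by
    rw [hXdef, inv_le_iff_one_le_mul₀' hDpos]; exact hlow
  clear_value X
  -- the window inequality  Y · G^E ≤ 2^{(K+1)!}  (K ≥ 3E, 6^{K!} ≤ (2^{K!})^3, Y ≤ 2^{K!})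
  have hwin_ineq : Y * G ^ E ≤ (2 : ℝ) ^ (K + 1)! := by
    set q : ℝ := (2 : ℝ) ^ K ! with hqdef
    have hq1 : 1 ≤ q := by rw [hqdef]; exact one_le_pow₀ (by norm_num)
    have e1 : (2 : ℝ) ^ (K + 1)! = q ^ (K + 1) := by
      rw [hqdef, ← pow_mul, Nat.factorial_succ, mul_comm]
    have hYq : Y ≤ q := by
      rw [hqdef]; exact hN₀Y.trans (pow_le_pow_right₀ (by norm_num) (Nat.factorial_le hNN₀))
    have hGq : G ≤ q ^ 3 := by
      rw [hGdef, hqdef, ← pow_mul]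
      calc (6 : ℝ) ^ K ! ≤ 8 ^ K ! := pow_le_pow_left₀ (by norm_num) (by norm_num) _
        _ = 2 ^ (K ! * 3) := by rw [mul_comm, pow_mul]; norm_num
    have hGE : G ^ E ≤ (q ^ 3) ^ E := pow_le_pow_left₀ hGpos.le hGq E
    rw [e1]
    calc Y * G ^ E ≤ q * (q ^ 3) ^ E := mul_le_mul hYq hGE (by positivity) (by positivity)
      _ = q ^ (3 * E + 1) := by rw [← pow_mul]; ring
      _ ≤ q ^ (K + 1) := pow_le_pow_right₀ hq1 (by omega)
  have htail2 : Γ * L * (2 / 2 ^ (K + 1)!) ≤ X / 2 := by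
    have hpow_pos : (0 : ℝ) < 2 ^ (K + 1)! := by positivity
    have h2 : (2 : ℝ) / 2 ^ (K + 1)! ≤ 2 / (Y * G ^ E) :=
      div_le_div_of_nonneg_left (by norm_num) (by positivity) hwin_ineq
    have h3 : Γ * L * (2 / (Y * G ^ E)) = X / 2 := by
      rw [hXdef, hYdef]
      field_simp
      ring
    calc Γ * L * (2 / 2 ^ (K + 1)!) ≤ Γ * L * (2 / (Y * G ^ E)) :=
          mul_le_mul_of_nonneg_left h2 (by positivity)
      _ = X / 2 := h3
  -- hence |P(ℓ₂, ℓ₃, θ)| ≥ X / 2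
  have hfinal : X / 2 ≤ ‖MvPolynomial.aeval (Fin.cons ((liouvilleNumber 2 : ℝ) : ℂ)
      (Fin.cons ((liouvilleNumber 3 : ℝ) : ℂ) θ) : Fin (n + 2) → ℂ) P‖ := by
    have ht := htail K
    have h1 := norm_sub_norm_le
      (MvPolynomial.aeval (Fin.cons ((s2 : ℝ) : ℂ) (Fin.cons ((s3 : ℝ) : ℂ) θ) : Fin (n + 2) → ℂ) P)
      (MvPolynomial.aeval (Fin.cons ((liouvilleNumber 2 : ℝ) : ℂ)
        (Fin.cons ((liouvilleNumber 3 : ℝ) : ℂ) θ) : Fin (n + 2) → ℂ) P)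
    rw [norm_sub_rev] at h1
    rw [hs2def, hs3def] at h1 hXle
    linarith
  refine le_trans ?_ hfinal
  -- it remains: exp(−Cst u^{d+3}) ≤ X / 2, i.e. 2 C₁ L^τ G^E ≤ exp(Cst u^{d+3})
  have hX2 : X / 2 = (2 * C₁ * L ^ τ * G ^ E)⁻¹ := by
    rw [hXdef, div_eq_mul_inv, ← mul_inv]
    congr 1
    ring
  rw [hX2, Real.exp_neg]
  refine inv_anti₀ (by positivity) ?_
  have hNfact : ((K ! : ℕ) : ℝ) ≤ A₀ * u ^ (d + 3) := by
    rw [hA₀def]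
    exact factorial_window_le (d := d + 1) hKle hN₀fact hN₀le hlogY0 hlogY hcY0 hu1
  have hqpow : G ^ E ≤ Real.exp (D * (K ! : ℕ)) := by
    rw [hGdef, hDdef, ← pow_mul]
    calc ((6 : ℝ) ^ (K ! * E)) ≤ (Real.exp 2) ^ (K ! * E) :=
          pow_le_pow_left₀ (by norm_num) six_le_exp_two' _
      _ = Real.exp (2 * (E : ℝ) * (K ! : ℕ)) := by
          rw [← Real.exp_nat_mul]; congr 1; push_cast; ring
  rw [hCstdef]
  exact two_mul_prod_le_exp hC₁pos (by linarith) (by rw [hudef]; linarith) hu1 (by omega)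
    hD0 hA₀0 (by positivity) hqpow hNfact

/-- **(M) THE BLOCK MEASURE** as a class statement: `MvPolyMeasure θ ⇒ LogPowMeasure (ℓ₂, ℓ₃, θ)`. -/
theorem logPowMeasure_cons_two_three {θ : Fin n → ℂ} (hθ : MvPolyMeasure θ) :
    LogPowMeasure (Fin.cons ((liouvilleNumber 2 : ℝ) : ℂ)
      (Fin.cons ((liouvilleNumber 3 : ℝ) : ℂ) θ) : Fin (n + 2) → ℂ) := fun d =>
  let ⟨C, hC, h⟩ := induced_logPow_measure_cons_two_three hθ d
  ⟨C, d + 3, hC, h⟩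

/-- **The concrete measured triple `(ℓ₂, ℓ₃, e)`** (mod the Nesterenko–Waldschmidt measure of `e`). -/
theorem logPowMeasure_two_three_exp_one (hNW : NWMeasure) :
    LogPowMeasure ![((liouvilleNumber 2 : ℝ) : ℂ), ((liouvilleNumber 3 : ℝ) : ℂ), cexp 1] :=
  logPowMeasure_cons_two_three (mvPolyMeasure_one_of_polyMeasure (polyMeasure_exp_one_of_NW hNW))

/-- **The concrete measured triple `(ℓ₂, ℓ₃, π)` — HYPOTHESIS-FREE** (the measure of `π` is tree-proved). -/
theorem logPowMeasure_two_three_pi :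
    LogPowMeasure ![((liouvilleNumber 2 : ℝ) : ℂ), ((liouvilleNumber 3 : ℝ) : ℂ), (Real.pi : ℂ)] :=
  logPowMeasure_cons_two_three (mvPolyMeasure_one_of_polyMeasure polyMeasure_pi)

end BlockMeasure

end Summit.Schanuel.Schanuel.Theorems.RootDecomp1KMeasuredWallCell

end
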